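import Summits.KontsevichZagierPeriods.KontsevichZagierPeriods.Theorems.HermiteRigidityReductionRigidityJoinProductReduction

/-!
# KontsevichZagierPeriods / HermiteRigidity — crux `ReductionRigidity` (stmt-KontsevichZagierPeriods-3407), line `Sketch` (Landen join island): the PRODUCT-SECTOR normal form

Route `KontsevichZagierPeriods/HermiteRigidity`, crux stmt-KontsevichZagierPeriods-3407 (`ReductionRigidity`),
crux-chain line `Sketch`, cycle-2 growth (the LANDEN JOIN island). Registered stub
`stub_joinProductNormalForm`, the closure form of the product-sector reduction
`stub_joinProductReduction` (`HermiteRigidityReductionRigidityJoinProductReduction.lean`):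

for every integer `q ≥ 2`, every `ℤ`-combination of product generators
`[□², x^a y^b/((q − x)^m (q − y)^n)]` is congruent modulo `KZ.relations` to a normal form
`[pt, α] + [□¹, β/(q − x)] + [□², ε/((q − x)(q − y))]` with `α, β, ε ∈ ℚ`.

Proof: `AddSubgroup.closure_induction` with the normal form as motive — generators by
`stub_joinProductReduction`; zero, sums and negatives by the rule-1b bookkeeping of the three one-parameter
carrier families (`carrier_zero`, `carrier_add` of `HermiteRigidityReductionRigidityLineReduction.lean`),
each additive in its rational parameter. No definitions are introduced.

References: M. Kontsevich, D. Zagier, *Periods* (2001), §1.2 rule (1) [cite: KontsevichZagier2001, §1.2];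
J. Ayoub, EMS Newsl. 91 (2014), Def. 10 [cite: Ayoub2014, Def. 10].
-/

noncomputable section

open MeasureTheory Set MvPolynomial

namespace Summit.KontsevichZagierPeriods.HermiteRigidity.ReductionRigidity

open Literature.NumberTheory.Transcendental
open Literature.NumberTheory.Transcendental.KZ

/-! ## Toolkit: the product normal-form carrier -/

/-- The product normal form `[□², ε/((N − x)(N − y))]` exists (`N ≥ 2`). [cite: KontsevichZagier2001, §1.1] -/
theorem joinProd_exists_nf2 {N : ℕ} (hN : 2 ≤ N) (ε : ℚ) :
    ∃ s : IntegralRep 2, s.domain = cube 2 ∧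
      EqOn s.integrand (fun p => (ε : ℝ) / (((N : ℝ) - p 0) * ((N : ℝ) - p 1))) (cube 2) := by
  obtain ⟨T, hT⟩ := joinProd_exists_nf2RFun hN ε
  exact ⟨T.rep, rfl, fun x _ => by rw [RFun.rep_integrand, hT]⟩

/-- The product normal-form family `ε ↦ ε/((N − x)(N − y))` is additive in its rational parameter.
[folklore] -/
theorem joinProd_nf2_family_add (N : ℕ) : ∀ (ε ε' : ℚ) (x : Fin 2 → ℝ),
    (((ε + ε' : ℚ) : ℝ) / (((N : ℝ) - x 0) * ((N : ℝ) - x 1))) =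
      (ε : ℝ) / (((N : ℝ) - x 0) * ((N : ℝ) - x 1)) + (ε' : ℝ) / (((N : ℝ) - x 0) * ((N : ℝ) - x 1)) := by
  intro ε ε' x
  push_cast
  ring

/-! ## The product-sector normal form -/

/-- **Stub `stub_joinProductNormalForm`** (crux `ReductionRigidity`, stmt-3407, line `Sketch`, Landen join
island): every element of the subgroup generated by the product generators
`[□², x^a y^b/((q − x)^m (q − y)^n)]` (`q ≥ 2`) is congruent modulo `KZ.relations` to a rational normal
form `[pt, α] + [□¹, β/(q − x)] + [□², ε/((q − x)(q − y))]` — closure induction over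
`stub_joinProductReduction`, the three carrier families being additive in their parameters (rule 1b).
[cite: KontsevichZagier2001, §1.2 rule (1)] -/
theorem stub_joinProductNormalForm : ∀ (q : ℕ), 2 ≤ q → ∀ c ∈ AddSubgroup.closure
      {c | ∃ (r : IntegralRep 2) (a b m n : ℕ), r.domain = cube 2 ∧
        EqOn r.integrand (fun p => p 0 ^ a * p 1 ^ b / (((q : ℝ) - p 0) ^ m * ((q : ℝ) - p 1) ^ n)) (cube 2) ∧
        c = KZ.of r},
    ∃ (α β ε : ℚ) (s₀ : IntegralRep 0) (s₁ : IntegralRep 1) (s₂ : IntegralRep 2),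
      s₀.domain = cube 0 ∧ EqOn s₀.integrand (fun _ => (α : ℝ)) (cube 0) ∧
      s₁.domain = cube 1 ∧ EqOn s₁.integrand (fun p => (β : ℝ) / ((q : ℝ) - p 0)) (cube 1) ∧
      s₂.domain = cube 2 ∧ EqOn s₂.integrand (fun p => (ε : ℝ) / (((q : ℝ) - p 0) * ((q : ℝ) - p 1))) (cube 2) ∧
      c - (KZ.of s₀ + KZ.of s₁ + KZ.of s₂) ∈ KZ.relations := by
  intro q hq
  -- the three carrier families, additive in the rational parameter
  set f0 : ℚ → (Fin 0 → ℝ) → ℝ := fun α _ => (α : ℝ) with hf0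
  set f1 : ℚ → (Fin 1 → ℝ) → ℝ := fun β p => (β : ℝ) / ((q : ℝ) - p 0) with hf1
  set f2 : ℚ → (Fin 2 → ℝ) → ℝ := fun ε p => (ε : ℝ) / (((q : ℝ) - p 0) * ((q : ℝ) - p 1)) with hf2
  obtain ⟨-, hA1, hA0⟩ := nf_families_additive q
  have hA2 := joinProd_nf2_family_add q
  intro c hc
  induction hc using AddSubgroup.closure_induction with
  | mem x hx =>
    -- a product generator: `stub_joinProductReduction`
    obtain ⟨r, a, b, m, n, hr, hri, rfl⟩ := hx
    exact stub_joinProductReduction q hq a b m n r hr hri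
  | zero =>
    -- zero: the three carriers with parameter `0` are relations
    obtain ⟨s₀, hs₀, hs₀i⟩ := exists_nf0 (0 : ℚ)
    obtain ⟨s₁, hs₁, hs₁i⟩ := exists_nf1 hq (0 : ℚ)
    obtain ⟨s₂, hs₂, hs₂i⟩ := joinProd_exists_nf2 hq (0 : ℚ)
    refine ⟨0, 0, 0, s₀, s₁, s₂, hs₀, hs₀i, hs₁, hs₁i, hs₂, hs₂i, ?_⟩
    rw [zero_sub, neg_mem_iff]
    exact KZ.relations.add_mem (KZ.relations.add_mem
      (carrier_zero (D := cube 0) f0 (fun x => by simp [hf0]) hs₀ hs₀i)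
      (carrier_zero (D := cube 1) f1 (fun x => by simp [hf1]) hs₁ hs₁i))
      (carrier_zero (D := cube 2) f2 (fun x => by simp [hf2]) hs₂ hs₂i)
  | add x y _ _ hx hy =>
    -- sums: rule 1b on each carrier family
    obtain ⟨α, β, ε, s₀, s₁, s₂, hs₀, hs₀i, hs₁, hs₁i, hs₂, hs₂i, hx⟩ := hx
    obtain ⟨α', β', ε', t₀, t₁, t₂, ht₀, ht₀i, ht₁, ht₁i, ht₂, ht₂i, hy⟩ := hy
    obtain ⟨u₀, hu₀, hu₀i⟩ := exists_nf0 (α + α')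
    obtain ⟨u₁, hu₁, hu₁i⟩ := exists_nf1 hq (β + β')
    obtain ⟨u₂, hu₂, hu₂i⟩ := joinProd_exists_nf2 hq (ε + ε')
    have e₀ := carrier_add (D := cube 0) f0 hA0 (β := α) (β' := α') hs₀ hs₀i ht₀ ht₀i hu₀ hu₀i
    have e₁ := carrier_add (D := cube 1) f1 hA1 (β := β) (β' := β') hs₁ hs₁i ht₁ ht₁i hu₁ hu₁i
    have e₂ := carrier_add (D := cube 2) f2 hA2 (β := ε) (β' := ε') hs₂ hs₂i ht₂ ht₂i hu₂ hu₂i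
    refine ⟨α + α', β + β', ε + ε', u₀, u₁, u₂, hu₀, hu₀i, hu₁, hu₁i, hu₂, hu₂i, ?_⟩
    have : x + y - (KZ.of u₀ + KZ.of u₁ + KZ.of u₂) =
        (x - (KZ.of s₀ + KZ.of s₁ + KZ.of s₂)) + (y - (KZ.of t₀ + KZ.of t₁ + KZ.of t₂))
          - (KZ.of u₀ - KZ.of s₀ - KZ.of t₀) - (KZ.of u₁ - KZ.of s₁ - KZ.of t₁)
          - (KZ.of u₂ - KZ.of s₂ - KZ.of t₂) := by abel
    rw [this]
    exact KZ.relations.sub_mem (KZ.relations.sub_mem (KZ.relations.sub_mem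
      (KZ.relations.add_mem hx hy) e₀) e₁) e₂
  | neg x _ hx =>
    -- negatives: rule 1b on each carrier family, the carriers with parameter `α + (−α)` being relations
    obtain ⟨α, β, ε, s₀, s₁, s₂, hs₀, hs₀i, hs₁, hs₁i, hs₂, hs₂i, hx⟩ := hx
    obtain ⟨t₀, ht₀, ht₀i⟩ := exists_nf0 (-α)
    obtain ⟨t₁, ht₁, ht₁i⟩ := exists_nf1 hq (-β)
    obtain ⟨t₂, ht₂, ht₂i⟩ := joinProd_exists_nf2 hq (-ε)
    obtain ⟨u₀, hu₀, hu₀i⟩ := exists_nf0 (α + -α)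
    obtain ⟨u₁, hu₁, hu₁i⟩ := exists_nf1 hq (β + -β)
    obtain ⟨u₂, hu₂, hu₂i⟩ := joinProd_exists_nf2 hq (ε + -ε)
    have e₀ := carrier_add (D := cube 0) f0 hA0 (β := α) (β' := -α) hs₀ hs₀i ht₀ ht₀i hu₀ hu₀i
    have e₁ := carrier_add (D := cube 1) f1 hA1 (β := β) (β' := -β) hs₁ hs₁i ht₁ ht₁i hu₁ hu₁i
    have e₂ := carrier_add (D := cube 2) f2 hA2 (β := ε) (β' := -ε) hs₂ hs₂i ht₂ ht₂i hu₂ hu₂i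
    have z₀ : KZ.of u₀ ∈ KZ.relations := carrier_zero (D := cube 0) f0 (fun x => by simp [hf0]) hu₀
      (by rw [add_neg_cancel] at hu₀i; exact hu₀i)
    have z₁ : KZ.of u₁ ∈ KZ.relations := carrier_zero (D := cube 1) f1 (fun x => by simp [hf1]) hu₁
      (by rw [add_neg_cancel] at hu₁i; exact hu₁i)
    have z₂ : KZ.of u₂ ∈ KZ.relations := carrier_zero (D := cube 2) f2 (fun x => by simp [hf2]) hu₂
      (by rw [add_neg_cancel] at hu₂i; exact hu₂i)
    refine ⟨-α, -β, -ε, t₀, t₁, t₂, ht₀, ht₀i, ht₁, ht₁i, ht₂, ht₂i, ?_⟩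
    have : -x - (KZ.of t₀ + KZ.of t₁ + KZ.of t₂) =
        -(x - (KZ.of s₀ + KZ.of s₁ + KZ.of s₂))
          + (KZ.of u₀ - KZ.of s₀ - KZ.of t₀) + (KZ.of u₁ - KZ.of s₁ - KZ.of t₁)
          + (KZ.of u₂ - KZ.of s₂ - KZ.of t₂) - KZ.of u₀ - KZ.of u₁ - KZ.of u₂ := by abel
    rw [this]
    exact KZ.relations.sub_mem (KZ.relations.sub_mem (KZ.relations.sub_mem
      (KZ.relations.add_mem (KZ.relations.add_mem (KZ.relations.add_mem
        (KZ.relations.neg_mem hx) e₀) e₁) e₂) z₀) z₁) z₂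

end Summit.KontsevichZagierPeriods.HermiteRigidity.ReductionRigidity

end
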